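import Summits.Ventures.PercRepro.C025ProfileThinGirthD
import Summits.Ventures.PercRepro.C025ProfileThinGirthArithGen
import Summits.Ventures.PercRepro.C025ProfileThinAll
import Summits.Ventures.PercRepro.C025Profile
import Summits.Ventures.PercRepro.TheoremNAll

/-!
# THE THIN REGIME OF SIMPLE MATROIDS IS CLOSED FOR EVERY `q` (night-3 g16)
**THEOREM (thin + `g`-circuit, every `g`)** `profileIneq_thinGen` / `hallIneq_thinGen`: for every `g ≥ 4`, every `q ≥ g (g − 2)` and every
finite matroid of girth `≥ g` (every set of `≤ g − 1` points has full rank) with a `g`-circuit `C₀` (`|C₀| = g`, `ρ(C₀) = g − 1`) in which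
every rank-`q` set has at most `q + 1` points, the row `(q, q+1)` of C-032 and its Hall form (C-033) hold — for EVERY `n`: the general
theorem `profileIneq_thinGirth_of_weights` (part D) with the closed-form cascade weights of `C025ProfileThinGirthArithGen` (`gen_weights`,
the uniform inner payment `σ = 2/f`) when `f = n − q − 1 ≥ q`; the zero certificate (`ThinTriangle.profileIneq_of_small`) when `f < q`.
The generated cascades `g = 4 … 8` (`profileIneq_thinFour` … `profileIneq_thinEight`, thresholds `q ≥ 6, 9, 12, 14, 18`) are the instances
`g = 4 … 8` of this theorem above `q ≥ g (g − 2) = 8, 15, 24, 35, 48`; below `g (g − 2)` the simple rule T(q, g, n) of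
`C025ProfileThinRowF` applies at every `n`. `profileIneq_thinGen_indep`: the hypotheses in Mathlib's `M.Indep` terms.
**THEOREM** `profileIneq_thin_simple_all` / `hallIneq_thin_simple_all` (`C025ProfileThinAll` / `C025ProfileThinAll63` with the `g`-cascade
theorem for EVERY `g` in place of the generated cascades `g = 4 … 8`): a dependent set of `≤ q + 2` points of minimum cardinality is a
`g₀`-circuit, `g₀ ≥ 3`; for `q ≤ g₀ (g₀ − 2)` the simple rule T(q, g₀, n) applies at every `n`, for `q > g₀ (g₀ − 2)` the `g₀`-cascade (the
triangle theorem when `g₀ = 3`, `profileIneq_thinGen` when `g₀ ≥ 4`); if no such set exists the girth is `≥ q + 3` and T(q, q + 3, n)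
applies (its size condition is `0 ≤ …`). So every finite simple matroid in which every rank-`q` set has at most `q + 1` points satisfies the
row `(q, q+1)` of C-032 and its Hall form (C-033) — for EVERY `q` and EVERY `n`. No hypothesis on `q`.
COROLLARY FOR THE CRUX: the bridge `c025_of_profile` of `C025Profile` sums the rows `(q, u)`, `q < u < p`; at `p = q + 2` the only row is
`(q, q+1)`, so `rls_succ_succ_of_profileIneq` gives C-025 at `(q + 2, q)` (`ThmN.RLS M (q + 2) q`) from that row alone, and
`rls_succ_succ_thin_simple`: **C-025 holds at `(q + 2, q)` on every thin(q) simple matroid, for EVERY `q`** — the window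
`q + 2 ≤ p ≤ q·2^(q+1)` of the gap of record for `q ≥ 18` is closed at its lower end on the thin regime.
-/
open scoped Matroid
namespace PercRepro
open Set Finset ThmH Staged
namespace ThinGirth
variable {α : Type} [DecidableEq α] {M : Matroid α} [M.Finite]

/-- **THEOREM (thin + `g`-circuit, every `g`)**: `g ≥ 4`, `q ≥ g (g − 2)`, girth `≥ g`, a `g`-circuit `K`, every rank-`q` set with
`≤ q + 1` points ⇒ the row `(q, q+1)` of (Π) and its Hall form, for EVERY `n`. -/
theorem profileIneq_thinGen (g q : ℕ) (hg : 4 ≤ g) (hq : g * (g - 2) ≤ q)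
    (hgirth : ∀ X ⊆ gr M, X.card + 1 ≤ g → rkN M X = X.card)
    (hthin : ∀ X ⊆ gr M, rkN M X = q → X.card ≤ q + 1)
    (K : Finset α) (hKg : K ⊆ gr M) (hKc : K.card = g) (hKrk : rkN M K + 1 = g) :
    Profile.ProfileIneq M q (q + 1) ∧ Profile.HallIneq M q (q + 1) := by
  rcases Nat.lt_or_ge ((gr M).card - q - 1) q with hlt | hge
  · exact ThinTriangle.profileIneq_of_small q hlt
  · have hgq : g ≤ q := by
      have h2 : 2 ≤ g - 2 := by omega
      have := Nat.mul_le_mul_left g h2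
      omega
    obtain ⟨a, b, sQ, σ, ha, hb, hsQ, hσ, hdem, hdem0, htop, hσab, hcap, hcapQ, hcapiii⟩ :=
      gen_weights g q (gr M).card hg hq hge
    exact profileIneq_thinGirth_of_weights q g (by omega) hgq hgirth hthin K hKg hKc hKrk a b sQ σ ha hb hsQ hσ
      hge hdem hdem0 htop hσab hcap hcapQ hcapiii

/-- THEOREM (thin + `g`-circuit, every `g`), the row alone. -/
theorem profileIneq_thinGen' (g q : ℕ) (hg : 4 ≤ g) (hq : g * (g - 2) ≤ q)
    (hgirth : ∀ X ⊆ gr M, X.card + 1 ≤ g → rkN M X = X.card)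
    (hthin : ∀ X ⊆ gr M, rkN M X = q → X.card ≤ q + 1)
    (K : Finset α) (hKg : K ⊆ gr M) (hKc : K.card = g) (hKrk : rkN M K + 1 = g) :
    Profile.ProfileIneq M q (q + 1) :=
  (profileIneq_thinGen g q hg hq hgirth hthin K hKg hKc hKrk).1

/-- THEOREM (thin + `g`-circuit, every `g`), the Hall form (C-033). -/
theorem hallIneq_thinGen (g q : ℕ) (hg : 4 ≤ g) (hq : g * (g - 2) ≤ q)
    (hgirth : ∀ X ⊆ gr M, X.card + 1 ≤ g → rkN M X = X.card)
    (hthin : ∀ X ⊆ gr M, rkN M X = q → X.card ≤ q + 1)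
    (K : Finset α) (hKg : K ⊆ gr M) (hKc : K.card = g) (hKrk : rkN M K + 1 = g) :
    Profile.HallIneq M q (q + 1) :=
  (profileIneq_thinGen g q hg hq hgirth hthin K hKg hKc hKrk).2

/-- **THEOREM (thin + `g`-circuit, every `g`), independence form**: `g ≥ 4`, `q ≥ g (g − 2)`, every set of `< g` points independent,
`K ⊆ E` a dependent `g`-set, every rank-`q` set with `≤ q + 1` points ⇒ the row `(q, q+1)` of (Π) and its Hall form. -/
theorem profileIneq_thinGen_indep (g q : ℕ) (hg : 4 ≤ g) (hq : g * (g - 2) ≤ q)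
    (hgirth : ∀ T ⊆ M.E, T.encard < g → M.Indep T)
    (hthin : ∀ X ⊆ gr M, rkN M X = q → X.card ≤ q + 1)
    (K : Finset α) (hKE : (K : Set α) ⊆ M.E) (hKc : K.card = g) (hKdep : ¬ M.Indep (K : Set α)) :
    Profile.ProfileIneq M q (q + 1) ∧ Profile.HallIneq M q (q + 1) := by
  have hKg : K ⊆ gr M := by
    intro k hk
    have : k ∈ ((gr M : Finset α) : Set α) := by rw [coe_gr]; exact hKE hk
    exact_mod_cast this
  have hgirth' : ∀ X ⊆ gr M, X.card + 1 ≤ g → rkN M X = X.card := by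
    intro X hXg hXc
    have hXE : (X : Set α) ⊆ M.E := by rw [← coe_gr]; exact_mod_cast hXg
    apply OneCircuit.rkN_eq_card_of_indep
    apply hgirth _ hXE
    rw [Set.encard_coe_eq_coe_finsetCard]
    exact_mod_cast (by omega : X.card < g)
  have hKrk : rkN M K + 1 = g := by
    have hle : rkN M K + 1 ≤ g := by
      by_contra h
      push Not at h
      have hg' : rkN M K = g := le_antisymm (hKc ▸ rkN_le_card K) (by omega)
      apply hKdep
      rw [Matroid.indep_iff_eRk_eq_encard_of_finite K.finite_toSet, Set.encard_coe_eq_coe_finsetCard, hKc,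
        ← rkN_eq_iff, hg']
    obtain ⟨k, hk⟩ : K.Nonempty := Finset.card_pos.mp (by omega)
    have hKk : rkN M (K.erase k) = (K.erase k).card :=
      hgirth' _ ((Finset.erase_subset k K).trans hKg) (by rw [Finset.card_erase_of_mem hk]; omega)
    have hmono : rkN M (K.erase k) ≤ rkN M K := rkN_mono (Finset.erase_subset k K)
    rw [Finset.card_erase_of_mem hk, hKc] at hKk
    omega
  exact profileIneq_thinGen g q hg hq hgirth' hthin K hKg hKc hKrk

/-- **THE THIN REGIME OF SIMPLE MATROIDS, EVERY `q`**: every finite simple matroid in which every rank-`q` set has at most `q + 1`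
points satisfies the row `(q, q+1)` of (Π) and its Hall form, for every `n`. -/
theorem profileIneq_thin_simple_all (q : ℕ)
    (hsimple : ∀ T ⊆ M.E, T.encard ≤ 2 → M.Indep T)
    (hthin : ∀ X ⊆ gr M, rkN M X = q → X.card ≤ q + 1) :
    Profile.ProfileIneq M q (q + 1) ∧ Profile.HallIneq M q (q + 1) := by
  rcases Nat.lt_or_ge ((gr M).card - q - 1) q with hlt | hge
  · exact ThinTriangle.profileIneq_of_small q hlt
  have hsimple' : ∀ X ⊆ gr M, X.card ≤ 2 → rkN M X = X.card := by
    intro X hXg hXc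
    have hXE : (X : Set α) ⊆ M.E := by rw [← coe_gr]; exact_mod_cast hXg
    apply OneCircuit.rkN_eq_card_of_indep
    apply hsimple _ hXE
    rw [Set.encard_coe_eq_coe_finsetCard]
    exact_mod_cast hXc
  -- the size condition of the simple rule T(q, g, n) at `f ≥ q` and `q ≤ g (g − 2)`
  have hsize : ∀ g : ℕ, 3 ≤ g → q ≤ g * (g - 2) → g * (q + 2 - g) ≤ (g - 1) * ((gr M).card - q - 1) := by
    intro g hg3 hqg
    calc g * (q + 2 - g) ≤ (g - 1) * q := by
          rcases Nat.lt_or_ge (q + 2) g with h | h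
          · rw [Nat.sub_eq_zero_of_le h.le]; simp
          · obtain ⟨g', rfl⟩ : ∃ g', g = g' + 3 := ⟨g - 3, by omega⟩
            have e1 : q + 2 - (g' + 3) = q - (g' + 1) := by omega
            have e2 : g' + 3 - 1 = g' + 2 := by omega
            have e3 : g' + 3 - 2 = g' + 1 := by omega
            rw [e1, e2]
            rw [e3] at hqg
            have hq1 : g' + 1 ≤ q := by omega
            zify [hq1]
            nlinarith
      _ ≤ (g - 1) * ((gr M).card - q - 1) := Nat.mul_le_mul_left _ hge
  by_cases hP : ∀ X ⊆ gr M, X.card ≤ q + 2 → rkN M X = X.card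
  · -- girth `≥ q + 3`: the simple rule with `g = q + 3` (its size condition is `0 ≤ …`)
    have hgq : ∀ T ⊆ M.E, T.encard < (q + 3 : ℕ) → M.Indep T :=
      indep_of_forall_rkN (g := q + 3) (fun X hXg hXc => hP X hXg (by omega))
    have hs := hsize (q + 3) (by omega)
      (by calc q ≤ q + 3 := by omega
            _ ≤ (q + 3) * (q + 3 - 2) := Nat.le_mul_of_pos_right _ (by omega))
    exact ⟨ThinRow.profileIneq_succ_of_thin_size q (q + 3) (by omega) hs hgq hthin,
      ThinRow.hallIneq_succ_of_thin_size q (q + 3) (by omega) hs hgq hthin⟩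
  · -- a dependent set of `≤ q + 2` points of minimum cardinality is a `g₀`-circuit, `g₀ ≥ 3`
    push Not at hP
    obtain ⟨X₀, hX₀g, hX₀c, hX₀r⟩ := hP
    set S := (gr M).powerset.filter (fun X => X.card ≤ q + 2 ∧ rkN M X ≠ X.card) with hS
    have hX₀S : X₀ ∈ S := by
      rw [hS, Finset.mem_filter, Finset.mem_powerset]
      exact ⟨hX₀g, hX₀c, hX₀r⟩
    obtain ⟨C, hCS, hCmin⟩ := Finset.exists_min_image S Finset.card ⟨X₀, hX₀S⟩
    rw [hS, Finset.mem_filter, Finset.mem_powerset] at hCS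
    obtain ⟨hCg, hCc, hCr⟩ := hCS
    -- every smaller subset of the ground set has full rank
    have hgirth : ∀ X ⊆ gr M, X.card + 1 ≤ C.card → rkN M X = X.card := by
      intro X hXg hXc
      by_contra hne
      have hXS : X ∈ S := by
        rw [hS, Finset.mem_filter, Finset.mem_powerset]
        exact ⟨hXg, by omega, hne⟩
      have := hCmin X hXS
      omega
    have hCrk : rkN M C + 1 = C.card := by
      have h1 : rkN M C ≤ C.card := rkN_le_card C
      have h2 : rkN M C ≠ C.card := hCr
      have hCpos : 0 < C.card := by
        by_contra h0
        push Not at h0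
        have := rkN_le_card (M := M) C
        omega
      obtain ⟨c, hc⟩ : C.Nonempty := Finset.card_pos.mp hCpos
      have hce := Finset.card_erase_of_mem hc
      have h3 := hgirth (C.erase c) ((Finset.erase_subset c C).trans hCg) (by omega)
      have h4 : rkN M (C.erase c) ≤ rkN M C := rkN_mono (Finset.erase_subset c C)
      omega
    have hC3 : 3 ≤ C.card := by
      by_contra h
      push Not at h
      exact hCr (hsimple' C hCg (by omega))
    have hgC : ∀ T ⊆ M.E, T.encard < (C.card : ℕ) → M.Indep T :=
      indep_of_forall_rkN (g := C.card) (fun X hXg hXc => hgirth X hXg hXc)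
    rcases Nat.lt_or_ge (C.card * (C.card - 2)) q with hbig | hsmall
    · -- above the cascade threshold: the `g₀`-cascade
      rcases Nat.lt_or_ge C.card 4 with h3 | h4
      · have hC3' : C.card = 3 := by omega
        have hq4 : 4 ≤ q := by rw [hC3'] at hbig; omega
        exact ThinTriangle.profileIneq_thinTriangle q hq4 hsimple' hthin C hCg hC3' (by omega)
      · exact profileIneq_thinGen C.card q h4 hbig.le hgirth hthin C hCg rfl hCrk
    · -- below it: the simple rule T(q, g₀, n)
      have hs := hsize C.card hC3 hsmall
      exact ⟨ThinRow.profileIneq_succ_of_thin_size q C.card hC3 hs hgC hthin,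
        ThinRow.hallIneq_succ_of_thin_size q C.card hC3 hs hgC hthin⟩

/-- The thin regime of simple matroids, every `q`: the row alone. -/
theorem profileIneq_thin_simple_all' (q : ℕ)
    (hsimple : ∀ T ⊆ M.E, T.encard ≤ 2 → M.Indep T)
    (hthin : ∀ X ⊆ gr M, rkN M X = q → X.card ≤ q + 1) :
    Profile.ProfileIneq M q (q + 1) :=
  (profileIneq_thin_simple_all q hsimple hthin).1

/-- The thin regime of simple matroids, every `q`: the Hall form (C-033). -/
theorem hallIneq_thin_simple_all (q : ℕ)
    (hsimple : ∀ T ⊆ M.E, T.encard ≤ 2 → M.Indep T)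
    (hthin : ∀ X ⊆ gr M, rkN M X = q → X.card ≤ q + 1) :
    Profile.HallIneq M q (q + 1) :=
  (profileIneq_thin_simple_all q hsimple hthin).2

/-- The row `(100, 101)` on every thin(100) simple matroid — every `n`, every girth (an instance beyond the generated cascades). -/
theorem profileIneq_hundred_thin_simple (hsimple : ∀ T ⊆ M.E, T.encard ≤ 2 → M.Indep T)
    (hthin : ∀ X ⊆ gr M, rkN M X = 100 → X.card ≤ 101) : Profile.ProfileIneq M 100 101 :=
  profileIneq_thin_simple_all' 100 hsimple hthin

/-- **The pointwise bridge at `p = q + 2`**: the row `(q, q+1)` of the profile inequality gives C-025 at `(q + 2, q)` for `M`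
(the proof of `c025_of_profile` with `Finset.Ioo q (q + 2) = {q + 1}`). -/
theorem rls_succ_succ_of_profileIneq (q : ℕ) (h : Profile.ProfileIneq M q (q + 1)) : ThmN.RLS M (q + 2) q := by
  unfold ThmN.RLS
  rw [PerFlat.ncard_Y_eq_card_Yq]
  have hY : ((PerFlat.Yq M (q + 2) q).card : ℚ) =
      ∑ u ∈ Finset.Ioo q (q + 2), ((Shadow.levelSet M u).card : ℚ) := by
    exact_mod_cast Profile.card_Yq_eq_sum (M := M) (q + 2) q
  calc phiK (q + 2) q *
        ({A : Set α | A ⊆ M.E ∧ M.eRk A = ((q + 2 : ℕ) : ℕ∞) ∧ M.eRk (M.E \ A) = (q : ℕ∞)}.ncard : ℚ)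
      ≤ phiK (q + 2) q * ((PerFlat.Uq M (q + 2) q).card : ℚ) := by
        apply mul_le_mul_of_nonneg_left _ (Profile.phiK_nonneg (q + 2) q)
        exact_mod_cast PerFlat.ncard_U_le_card_Uq M (q + 2) q
    _ = ∑ u ∈ Finset.Ioo q (q + 2),
          ((PerFlat.Uq M (q + 2) q).card : ℚ) * ((Nat.choose (q + 2 + q) u : ℚ) / (Nat.choose (q + 2 + q) q : ℚ)) := by
        rw [Profile.phiK_eq_sum_levels, Finset.sum_mul]
        apply Finset.sum_congr rfl
        intro u _
        ring
    _ ≤ ∑ u ∈ Finset.Ioo q (q + 2), ((Shadow.levelSet M u).card : ℚ) := by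
        apply Finset.sum_le_sum
        intro u hu
        rw [Finset.mem_Ioo] at hu
        have hu' : u = q + 1 := by omega
        subst hu'
        exact Profile.card_Uq_mul_le_card_Lq (by omega) h
    _ = ((PerFlat.Yq M (q + 2) q).card : ℚ) := hY.symm

/-- **C-025 AT `(q + 2, q)` ON THE THIN REGIME, EVERY `q`**: every finite simple matroid in which every rank-`q` set has at most
`q + 1` points satisfies the rank level-set inequality `ThmN.RLS M (q + 2) q`. -/
theorem rls_succ_succ_thin_simple (q : ℕ)
    (hsimple : ∀ T ⊆ M.E, T.encard ≤ 2 → M.Indep T)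
    (hthin : ∀ X ⊆ gr M, rkN M X = q → X.card ≤ q + 1) : ThmN.RLS M (q + 2) q :=
  rls_succ_succ_of_profileIneq q (profileIneq_thin_simple_all' q hsimple hthin)

end ThinGirth
end PercRepro
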